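import Summits.HodgeConjecture.CorCM.GaloisQuaternionCyclicTwoSheetNorm
import Summits.HodgeConjecture.CorCM.GaloisWeightCertificateLift
import Summits.HodgeConjecture.CorCM.GaloisQuaternionCyclicLift
import HarnessLib

/-!
# `Q_{4m} × C_p ↪ Gal(K/ℚ)` through `c` with `C_p` normal + a GAUSS WORD with vanishing two-sheet norm ⟹ BAD
# (the two-sheet norm format, Galois dress: an `O(m²)` certificate replaces the balanced-set search)

COR-CM (cell `pub-hodgecm2`), binder seat b04 (gen 41), count-neutral own lane «Galois-CM-type classification» (blanket
`CorCM/Galois*`).  KERNEL ONLY: theorems; no definition, no named fact, no `sorry`.  `HC_CM` is neither used nor claimed.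

THE CHAIN.  `CorCM/GaloisQuaternionCyclicTwoSheetNorm` (model theorem: a Gauss word `T₁ ⊆ Q_{4m} × C_p` whose two-sheet norm vanishes in
`ℤ[η][X]/(X^{2m} − 1)` carries a non-zero `c₁`-antisymmetric rational weight annihilated by its right translates and balanced over `C_p`)
→ `CorCM/GaloisWeightCertificateLift` (such a weight certificate on a subgroup `H₀ ∋ c` of `Gal(K/ℚ)` containing the normal `C_p` lifts)
→ a PRIMITIVE DEGENERATE CM type on `K`, a simple CM abelian variety of dimension `[K:ℚ]/2` with an exceptional Hodge class on a power.
The per-instance obligations are all `decide`s of size `O(|H₀|)` (CM property and trivial left stabiliser of `T₁`) and `O(m²)` (the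
norm identities `E₁(d) = E₂(d) = 0`, `d ∈ ℤ/2m`) — compare gen 40's list format (`|H₀|·#D ≈ 4m·p·2p` memberships).  Instances: the
reflection-ansatz words of gen 41 (`CorCM/GaloisQuaternion*Cyclic*Word`).

* **`exists_simple_degenerate_of_quaternion_cyclic_word`**.

## References

* [Shimura1998] G. Shimura, *Abelian Varieties with Complex Multiplication and Modular Functions*, §6.2 Thm. 3, §8.2 Prop. 26.
* [Gordon1999HodgeAVSurvey] B. B. Gordon, *A survey of the Hodge conjecture for abelian varieties*, Thm. 6.4, §9.3, Prop. 9.4.1.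
* [Kubota1965] T. Kubota, *On the field extension by complex multiplication*, Trans. AMS 118 (1965), §4 Lemma 2.
* [Dodson1984] B. Dodson, *The structure of Galois groups of CM-fields*, Trans. AMS 283 (1984), §3.1.1, §5.3.
-/

noncomputable section

open CategoryTheory CategoryTheory.Limits NumberField
open scoped BigOperators

namespace Summit.HodgeConjecture.CorCM.GaloisModels

open Literature.NumberTheory.ComplexMultiplication
open Literature.AlgebraicGeometry.Motives (AbelianVariety CMType)
open Literature.AlgebraicGeometry.HodgeTheory
open Literature.AlgebraicGeometry.ComplexMultiplication (IsCMTypeRealisation)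
open Literature.AlgebraicGeometry.Pohlmann1968
open Literature.Barriers.HodgeConjecture (divisorClassesSpan)
open Summit.HodgeConjecture.CorCM.GaloisRank
open Summit.HodgeConjecture.CorCM.GaloisQuaternionCyclic (exists_balanced_annihilator_of_twoSheet_word)
open QuaternionGroup

variable {K : Type} [Field K] [NumberField K] [IsCMField K]

/-- **`Q_{4m} × C_p ↪ Gal(K/ℚ)` THROUGH `c` WITH `C_p` NORMAL + A GAUSS WORD WITH VANISHING TWO-SHEET NORM ⟹ BAD.**
`A, X, u ∈ Gal(K/ℚ)` with `ord A = 2m`, `X² = Aᵐ = c`, `XAX⁻¹ = A⁻¹`, `ord u = p`, `[A,u] = [X,u] = 1`, `⟨u⟩ ◁ Gal`, `m ≥ 2`, `gcd(4m,p) = 1`,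
`p ≡ 3 (mod 4)` prime; a set `T₁ = {P}` on `Q_{4m} × C_p` whose fibres over `aʲ`, `x aʲ` are unions of `{0}`, squares, non-squares of
`ℤ/p` given by bits (`hPa`, `hPx`; the squares through any Boolean indicator `sq`, so that instances never evaluate
`IsSquare` over the group), which is a CM set for `(aᵐ, 1)` with trivial left stabiliser, and whose letters `α = z − n`, `β = r − n`
satisfy the two-sheet norm identities `E₁(d) = E₂(d) = 0` (`d ∈ ℤ/2m`).  Then `K` carries a primitive DEGENERATE CM type: a simple CM
abelian variety of dimension `[K:ℚ]/2` with a rational `(p,p)` class outside the divisor ring on some power.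
[cite: Shimura1998, §6.2 Thm. 3 and §8.2 Prop. 26] [cite: Gordon1999HodgeAVSurvey, Thm. 6.4 and §9.3] [cite: Kubota1965, §4 Lemma 2] -/
theorem exists_simple_degenerate_of_quaternion_cyclic_word [IsGalois ℚ K] {m p : ℕ} [NeZero m] [Fact p.Prime]
    (hm : 2 ≤ m) (hp3 : p % 4 = 3) (hcop : Nat.Coprime (4 * m) p) {A X u : K ≃ₐ[ℚ] K} (hA : orderOf A = 2 * m)
    (hX : X * X = A ^ m) (hXA : X * A * X⁻¹ = A⁻¹) (hc : A ^ m = (IsCMField.complexConj K).restrictScalars ℚ)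
    (hu : orderOf u = p) (hAu : A * u = u * A) (hXu : X * u = u * X) (hnorm : (Subgroup.zpowers u).Normal)
    (zu ru nu zv rv nv : ZMod (2 * m) → Bool) (sq : ZMod p → Bool) (hsq : ∀ v, sq v = true ↔ IsSquare v)
    (P : QuaternionGroup m × Multiplicative (ZMod p) → Prop) [DecidablePred P]
    (hPa : ∀ (j : ZMod (2 * m)) (v : ZMod p), P (a j, Multiplicative.ofAdd v) ↔
      (if v = 0 then zu j else if sq v then ru j else nu j) = true)
    (hPx : ∀ (j : ZMod (2 * m)) (v : ZMod p), P (xa j, Multiplicative.ofAdd v) ↔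
      (if v = 0 then zv j else if sq v then rv j else nv j) = true)
    (hcm₁ : ∀ x, P x ↔ ¬ P (((a m, 1) : QuaternionGroup m × Multiplicative (ZMod p)) * x))
    (hprim₁ : ∀ v : QuaternionGroup m × Multiplicative (ZMod p), v ≠ 1 → ∃ w, ¬ (P w ↔ P (v * w)))
    (hE₁ : ∀ d : ZMod (2 * m), ∑ j : ZMod (2 * m),
      ((((zu (j + d)).toNat : ℤ) - (nu (j + d)).toNat) * (((zu j).toNat : ℤ) - (nu j).toNat) -
          ((p + 1) / 4 : ℕ) * ((((ru (j + d)).toNat : ℤ) - (nu (j + d)).toNat) * (((ru j).toNat : ℤ) - (nu j).toNat)) +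
        ((((zv (j + d)).toNat : ℤ) - (nv (j + d)).toNat) * (((zv j).toNat : ℤ) - (nv j).toNat) -
          ((p + 1) / 4 : ℕ) * ((((rv (j + d)).toNat : ℤ) - (nv (j + d)).toNat) * (((rv j).toNat : ℤ) - (nv j).toNat)))) = 0)
    (hE₂ : ∀ d : ZMod (2 * m), ∑ j : ZMod (2 * m),
      ((((zu (j + d)).toNat : ℤ) - (nu (j + d)).toNat) * (((ru j).toNat : ℤ) - (nu j).toNat) +
          (((zu j).toNat : ℤ) - (nu j).toNat) * (((ru (j + d)).toNat : ℤ) - (nu (j + d)).toNat) -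
          (((ru (j + d)).toNat : ℤ) - (nu (j + d)).toNat) * (((ru j).toNat : ℤ) - (nu j).toNat) +
        ((((zv (j + d)).toNat : ℤ) - (nv (j + d)).toNat) * (((rv j).toNat : ℤ) - (nv j).toNat) +
          (((zv j).toNat : ℤ) - (nv j).toNat) * (((rv (j + d)).toNat : ℤ) - (nv (j + d)).toNat) -
          (((rv (j + d)).toNat : ℤ) - (nv (j + d)).toNat) * (((rv j).toNat : ℤ) - (nv j).toNat))) = 0) :
    ∃ (Φ : CMType K) (φ₀ : K →+* ℂ) (A : AbelianVariety ℂ) (ι : 𝓞 K →+* End A)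
      (θ : K →+* Module.End ℂ (complexBetti A.X 1)),
      IsPrimitive (ℂ ≃+* ℂ) Φ.1 φ₀ ∧ ¬ IsNondegenerate Φ ∧ IsCMTypeRealisation Φ A ι θ ∧ A.IsSimple ∧
      A.dim = Module.finrank ℚ K / 2 ∧
      ∃ n p : ℕ, ∃ x : complexBetti (⨁ fun _ : Fin n => A).X (2 * p), IsRationalClass x ∧
        IsOfHodgeType (⨁ fun _ : Fin n => A).dim (⨁ fun _ : Fin n => A).X (2 * p) p p x ∧
        x ∉ divisorClassesSpan (⨁ fun _ : Fin n => A).X (⨁ fun _ : Fin n => A).dim p := by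
  classical
  have hpr : p.Prime := Fact.out
  haveI : NeZero p := ⟨hpr.ne_zero⟩
  have hp2 : p ≠ 2 := by rintro rfl; norm_num at hp3
  -- the word as a finset and its balanced annihilator (model theorem)
  set T₁ : Finset (QuaternionGroup m × Multiplicative (ZMod p)) := Finset.univ.filter P with hT₁_def
  have hT₁ : ∀ x, x ∈ T₁ ↔ P x := fun x => by simp [hT₁_def]
  have hite : ∀ (z r n : Bool) (v : ZMod p), (if v = 0 then z else if sq v then r else n) =
      (if v = 0 then z else if IsSquare v then r else n) := fun z r n v => by
    by_cases h0 : v = 0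
    · simp [h0]
    · by_cases hs : IsSquare v
      · simp [h0, hs, (hsq v).mpr hs]
      · have : sq v = false := by simpa [hs] using (hsq v).not
        simp [h0, hs, this]
  obtain ⟨b₁, hb₁, hanti₁, hann₁, hbal₁⟩ := exists_balanced_annihilator_of_twoSheet_word hp3 zu ru nu zv rv nv T₁
    (fun j v => by rw [hT₁, hPa, hite]) (fun j v => by rw [hT₁, hPx, hite]) hE₁ hE₂
  -- the embedding `ι : Q_{4m} × C_p ↪ Gal(K/ℚ)` and the normal subgroup `⟨u⟩ = ι(C_p)`
  obtain ⟨ι, hιinj, hιa, hιxa, hιu, hιq⟩ :=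
    exists_injective_hom_quaternion_prod_cyclic hm hcop hA hX hXA hu hAu hXu
  have hmval : ((m : ℕ) : ZMod (2 * m)).val = m := by
    rw [ZMod.val_natCast]
    exact Nat.mod_eq_of_lt (by have := NeZero.ne m; omega)
  have hιc : ι (a m, 1) = (IsCMField.complexConj K).restrictScalars ℚ := by rw [hιa, hmval, hc]
  have hurange : ∀ k : ℕ, u ^ k = ι (1, Multiplicative.ofAdd (k : ZMod p)) := fun k => by
    rw [hιu, ZMod.val_natCast, ← hu, pow_mod_orderOf]
  have hNι : ∀ n ∈ Subgroup.zpowers u, n ∈ Set.range ι := by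
    intro n hn
    obtain ⟨k, rfl⟩ := ((isOfFinOrder_of_finite u).mem_powers_iff_mem_zpowers.mpr hn)
    exact ⟨_, (hurange k).symm⟩
  have hcN : (IsCMField.complexConj K).restrictScalars ℚ ∉ Subgroup.zpowers u := by
    intro hmem
    obtain ⟨k, hk⟩ := ((isOfFinOrder_of_finite u).mem_powers_iff_mem_zpowers.mpr hmem)
    have hcp : ((IsCMField.complexConj K).restrictScalars ℚ) ^ p = 1 := by
      rw [← hk, ← pow_mul, mul_comm, pow_mul, ← hu, pow_orderOf_eq_one, one_pow]
    obtain ⟨r, hr⟩ := hpr.odd_of_ne_two hp2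
    have hcc : ((IsCMField.complexConj K).restrictScalars ℚ) ^ 2 = 1 := by
      rw [pow_two]; exact GaloisOctic.complexConj_mul_self
    rw [hr, pow_succ, pow_mul, hcc, one_pow, one_mul] at hcp
    exact model_complexConj_ne_one (MulEquiv.refl _) rfl hcp
  have hN1 : Subgroup.zpowers u ≠ ⊥ := by
    rw [Ne, Subgroup.zpowers_eq_bot]
    intro h1
    rw [h1, orderOf_one] at hu
    exact hpr.one_lt.ne' hu.symm
  -- `N₁ = {(1, v)} = ι⁻¹⟨u⟩`
  let emb : ZMod p ↪ QuaternionGroup m × Multiplicative (ZMod p) :=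
    ⟨fun v => (1, Multiplicative.ofAdd v), fun v w h => by simpa using congrArg Prod.snd h⟩
  set N₁ : Finset (QuaternionGroup m × Multiplicative (ZMod p)) := Finset.univ.map emb with hN₁_def
  have hN₁ : ∀ n₁, n₁ ∈ N₁ ↔ ι n₁ ∈ Subgroup.zpowers u := by
    intro n₁
    constructor
    · intro h
      obtain ⟨v, -, rfl⟩ := Finset.mem_map.mp h
      change ι (1, Multiplicative.ofAdd v) ∈ Subgroup.zpowers u
      rw [hιu]
      exact Subgroup.pow_mem _ (Subgroup.mem_zpowers u) _
    · intro h
      obtain ⟨k, hk⟩ := ((isOfFinOrder_of_finite u).mem_powers_iff_mem_zpowers.mpr h)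
      change u ^ k = ι n₁ at hk
      rw [hurange] at hk
      have := hιinj hk
      exact Finset.mem_map.mpr ⟨(k : ZMod p), Finset.mem_univ _, this⟩
  have hbal₁' : ∀ x, ∑ n ∈ N₁, b₁ (x * n) = 0 := fun x => by
    rw [hN₁_def, Finset.sum_map]
    exact hbal₁ x
  exact exists_simple_degenerate_of_subgroup_annihilator ι hιinj (a m, 1) hιc (Subgroup.zpowers u) hNι hcN hN1 N₁ hN₁
    T₁ (fun x => by rw [hT₁, hT₁]; exact hcm₁ x) (fun v hv => by
      obtain ⟨w, hw⟩ := hprim₁ v hv; exact ⟨w, by rwa [hT₁, hT₁]⟩) b₁ hanti₁ hann₁ hb₁ hbal₁'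

end Summit.HodgeConjecture.CorCM.GaloisModels

end
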